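import Literature.Geometry.Lorentzian.KerrLowFrequencyPotential
import HarnessLib

/-!
# The separated potential at low frequency for `m ≠ 0` and small `a`: the three properties of
# Dafermos–Rodnianski–Shlapentokh-Rothman §8.7.1, quantitatively

(family `gr`, infrastructure for statement **gr.S24**; namespace `Literature.Geometry.Lorentzian.Kerr`)

Proposition 8.7.1 of Dafermos–Rodnianski–Shlapentokh-Rothman (*Decay for solutions of the wave
equation on Kerr exterior spacetimes III*, arXiv:1402.7034 = Ann. of Math. 183 (2016)) concerns the
bounded-frequency range `𝓖_♭` with `|ω| ≤ ω_low`, `m ≠ 0` and `0 ≤ a < ã₀` ("`ω_low`, `ã₀`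
sufficiently small"), and rests on three properties of Carter's potential `V` there: "for every
`−∞ < α < β < ∞`, if we require `ã` and `ω_low` sufficiently small … `r ∈ [α, β] ⟹ V − ω² > 0`";
"for sufficiently large `r*`, independent of the frequency parameters, `V' < 0`" (and
`(r*V)' < 0`); "for sufficiently small `ã₀` and sufficiently negative `r*`, independent of the
frequency parameters, `V' > 0`". This file proves explicit versions, treating the potential as a
perturbation of the axisymmetric one of `KerrLowFrequencyPotential`:
`V = V_axi + P`, `V_axi = ΛΔ/(r² + a²)² + V₁`, **`P = (4Mramω − a²m²)/(r² + a²)²`**, under the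
small-`a` hypotheses `2a ≤ M`, `20·aω_l ≤ 1` (`|ω| ≤ ω_l`), and (middle) `2a² ≤ Ms`, `8Maω_l ≤ s`.

* `Kerr.pertPotential`, `Kerr.sepPotential_eq_axi_add_pert`, `Kerr.hasDerivAt_pertPotential`,
  `Kerr.abs_pertPotential_le`, `Kerr.abs_pertPotentialDeriv_le`.
* small-`a` bounds: `Kerr.sqrt_ge_smallA` (`√(M² − a²) ≥ (43/50)M`), `Kerr.rPlus_ge_smallA`,
  `Kerr.horizonSlope_ge_smallA` (**`κ_H ≥ 1/(14M³)`**), `Kerr.rPlus_sub_rMinus_ge_smallA`.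
* far: `Kerr.sepPotential_axi_far_ratio'` (the axisymmetric ratio with slack, `(8/5)V_axi ≤ rq(−V_axi')`
  for `r ≥ 20M`) and **`Kerr.sepPotential_far_ratio_smallA`** (`(3/2)V ≤ rq(−V')` for `r ≥ 20M`),
  `Kerr.sepPotential_ge_smallA_far` (`V ≥ V₁ ≥ M/(2r³)`).
* near: **`Kerr.deriv_sepPotential_rPlus_ge_smallA`** (`dV/dr(r₊) ≥ κ_H`: the `Λ`-term
  `2(r₊² + a²)(r₊ − M)Λ` absorbs `4maMω(a² − 3r₊²)` because `Λ ≥ |m|` and `r₊ − M ≥ 6Maω_l`),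
  `Kerr.deriv_sepPotential_near_smallA`, `Kerr.sepPotentialTilde_near_bounds_smallA`
  (two-sided bounds for `Ṽ = V − V(r₊)` on `[r₊, r₊ + s]`).
* middle: `Kerr.sepPotential₁_le_sepPotential_smallA` (`V ≥ V₁` on `r ≥ r₊ + s`, since
  `|P| ≤ ΛΔ/(r² + a²)²` there).

No named facts (D-0026); everything is proved.

## References

* M. Dafermos, I. Rodnianski, Y. Shlapentokh-Rothman, arXiv:1402.7034 = Ann. of Math. 183 (2016),
  §6.2 ((V0def)), §8.7.1 (the three bullet properties of `V` in the proof of Prop. 8.7.1; the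
  constants `R₁*`, `R₂*`, `ã₀`) (key `DafermosRodnianskiShlapentokhrothman2014`).
-/

noncomputable section

open Set

namespace Literature.Geometry.Lorentzian

namespace Kerr

/-! ### The perturbation `P = (4Mramω − a²m²)/(r² + a²)²` -/

/-- **The `m`-dependent part of `V₀`**: `P = (4Mramω − a²m²)/(r² + a²)²`, so that
`V₀ = ΛΔ/(r² + a²)² + P` (DRSR arXiv:1402.7034, (V0def)). [cite: DafermosRodnianskiShlapentokhrothman2014, §6.2] -/
def pertPotential (M a ω : ℝ) (m : ℤ) (r : ℝ) : ℝ :=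
  (4 * M * r * a * m * ω - a ^ 2 * (m : ℝ) ^ 2) / (r ^ 2 + a ^ 2) ^ 2

/-- The derivative `dP/dr = (4Mamω(a² − 3r²) + 4ra²m²)/(r² + a²)³` of `pertPotential`. [folklore] -/
def pertPotentialDeriv (M a ω : ℝ) (m : ℤ) (r : ℝ) : ℝ :=
  (4 * M * a * m * ω * (a ^ 2 - 3 * r ^ 2) + 4 * r * a ^ 2 * (m : ℝ) ^ 2) / (r ^ 2 + a ^ 2) ^ 3

/-- `V₀ = ΛΔ/(r² + a²)² + P`. [cite: DafermosRodnianskiShlapentokhrothman2014, §6.2] -/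
theorem sepPotential₀_eq_axi_add_pert (M a ω : ℝ) (m : ℤ) (Λ r : ℝ) :
    sepPotential₀ M a ω m Λ r = sepPotential₀ M a ω 0 Λ r + pertPotential M a ω m r := by
  rw [sepPotential₀_axi_eq]
  unfold sepPotential₀ pertPotential
  ring

/-- **`V = V_axi + P`** with `V_axi` the axisymmetric (`m = 0`) potential. [cite: DafermosRodnianskiShlapentokhrothman2014, §6.2] -/
theorem sepPotential_eq_axi_add_pert (M a ω : ℝ) (m : ℤ) (Λ r : ℝ) :
    sepPotential M a ω m Λ r = sepPotential M a ω 0 Λ r + pertPotential M a ω m r := by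
  unfold sepPotential
  rw [sepPotential₀_eq_axi_add_pert]
  ring

/-- `dP/dr = pertPotentialDeriv` wherever `r² + a² ≠ 0`. [folklore] -/
theorem hasDerivAt_pertPotential (M a ω : ℝ) (m : ℤ) {r : ℝ} (hr : r ^ 2 + a ^ 2 ≠ 0) :
    HasDerivAt (pertPotential M a ω m) (pertPotentialDeriv M a ω m r) r := by
  have hnum : HasDerivAt (fun s : ℝ ↦ 4 * M * s * a * m * ω - a ^ 2 * (m : ℝ) ^ 2)
      (4 * M * a * m * ω) r := by
    have h := ((hasDerivAt_id r).const_mul (4 * M * a * m * ω)).sub_const (a ^ 2 * (m : ℝ) ^ 2)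
    have h' : HasDerivAt (fun s : ℝ ↦ 4 * M * a * m * ω * s - a ^ 2 * (m : ℝ) ^ 2)
        (4 * M * a * m * ω * 1) r := h
    have heq : (fun s : ℝ ↦ 4 * M * s * a * m * ω - a ^ 2 * (m : ℝ) ^ 2) =
        fun s ↦ 4 * M * a * m * ω * s - a ^ 2 * (m : ℝ) ^ 2 := by
      funext s; ring
    rw [heq]
    exact h'.congr_deriv (by ring)
  have hden := hasDerivAt_sq_add_sq_pow a 2 r
  have h := hnum.div hden (pow_ne_zero 2 hr)
  unfold pertPotential pertPotentialDeriv
  refine h.congr_deriv ?_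
  have hD : (r ^ 2 + a ^ 2) ≠ 0 := hr
  field_simp
  push_cast
  ring

/-- `deriv V = deriv V_axi + dP/dr` wherever `r² + a² ≠ 0`. [folklore] -/
theorem deriv_sepPotential_eq_axi_add_pert (M a ω : ℝ) (m : ℤ) (Λ : ℝ) {r : ℝ}
    (hr : r ^ 2 + a ^ 2 ≠ 0) :
    deriv (sepPotential M a ω m Λ) r =
      deriv (sepPotential M a ω 0 Λ) r + pertPotentialDeriv M a ω m r := by
  have h1 := hasDerivAt_sepPotential M a ω 0 Λ hr
  have h2 := hasDerivAt_pertPotential M a ω m hr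
  have heq : sepPotential M a ω m Λ = sepPotential M a ω 0 Λ + pertPotential M a ω m :=
    funext fun s ↦ by rw [Pi.add_apply]; exact sepPotential_eq_axi_add_pert M a ω m Λ s
  rw [heq, (h1.add h2).deriv, h1.deriv]

/-- **`|P| ≤ (4Mra|m|ω_l + a²m²)/r⁴`** for `|ω| ≤ ω_l`, `0 ≤ a`, `0 ≤ M`, `0 < r`. [folklore] -/
theorem abs_pertPotential_le {M a ω ωl r : ℝ} {m : ℤ} (hM : 0 ≤ M) (ha0 : 0 ≤ a) (hr : 0 < r)
    (hω : |ω| ≤ ωl) :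
    |pertPotential M a ω m r| ≤ (4 * M * r * a * |(m : ℝ)| * ωl + a ^ 2 * (m : ℝ) ^ 2) / r ^ 4 := by
  have hωl : 0 ≤ ωl := (abs_nonneg ω).trans hω
  unfold pertPotential
  rw [abs_div, abs_of_pos (by positivity : (0 : ℝ) < (r ^ 2 + a ^ 2) ^ 2)]
  have hnum : |4 * M * r * a * m * ω - a ^ 2 * (m : ℝ) ^ 2| ≤
      4 * M * r * a * |(m : ℝ)| * ωl + a ^ 2 * (m : ℝ) ^ 2 := by
    refine (abs_sub _ _).trans ?_
    have h1 : |4 * M * r * a * m * ω| ≤ 4 * M * r * a * |(m : ℝ)| * ωl := by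
      rw [show 4 * M * r * a * m * ω = (4 * M * r * a) * (m * ω) by ring, abs_mul,
        abs_of_nonneg (by positivity : (0 : ℝ) ≤ 4 * M * r * a), abs_mul]
      have := mul_le_mul_of_nonneg_left hω (abs_nonneg (m : ℝ))
      nlinarith [abs_nonneg (m : ℝ), mul_nonneg (mul_nonneg (mul_nonneg (by norm_num : (0:ℝ) ≤ 4) hM) hr.le) ha0]
    have h2 : |a ^ 2 * (m : ℝ) ^ 2| = a ^ 2 * (m : ℝ) ^ 2 := abs_of_nonneg (by positivity)
    linarith
  have hden : r ^ 4 ≤ (r ^ 2 + a ^ 2) ^ 2 := by nlinarith [sq_nonneg a, sq_nonneg r]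
  calc |4 * M * r * a * m * ω - a ^ 2 * (m : ℝ) ^ 2| / (r ^ 2 + a ^ 2) ^ 2
      ≤ (4 * M * r * a * |(m : ℝ)| * ωl + a ^ 2 * (m : ℝ) ^ 2) / (r ^ 2 + a ^ 2) ^ 2 := by
        gcongr
    _ ≤ (4 * M * r * a * |(m : ℝ)| * ωl + a ^ 2 * (m : ℝ) ^ 2) / r ^ 4 := by
        apply div_le_div_of_nonneg_left (by positivity) (by positivity) hden

/-- **`|dP/dr| ≤ (12Ma|m|ω_l r² + 4ra²m²)/r⁶`** for `|ω| ≤ ω_l`, `0 ≤ a ≤ r`, `0 ≤ M`, `0 < r`.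
[folklore] -/
theorem abs_pertPotentialDeriv_le {M a ω ωl r : ℝ} {m : ℤ} (hM : 0 ≤ M) (ha0 : 0 ≤ a) (hr : 0 < r)
    (har : a ≤ r) (hω : |ω| ≤ ωl) :
    |pertPotentialDeriv M a ω m r| ≤
      (12 * M * a * |(m : ℝ)| * ωl * r ^ 2 + 4 * r * a ^ 2 * (m : ℝ) ^ 2) / r ^ 6 := by
  have hωl : 0 ≤ ωl := (abs_nonneg ω).trans hω
  unfold pertPotentialDeriv
  rw [abs_div, abs_of_pos (by positivity : (0 : ℝ) < (r ^ 2 + a ^ 2) ^ 3)]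
  have ha2 : a ^ 2 ≤ r ^ 2 := by nlinarith
  have hnum : |4 * M * a * m * ω * (a ^ 2 - 3 * r ^ 2) + 4 * r * a ^ 2 * (m : ℝ) ^ 2| ≤
      12 * M * a * |(m : ℝ)| * ωl * r ^ 2 + 4 * r * a ^ 2 * (m : ℝ) ^ 2 := by
    refine (abs_add_le _ _).trans ?_
    have h1 : |4 * M * a * m * ω * (a ^ 2 - 3 * r ^ 2)| ≤ 12 * M * a * |(m : ℝ)| * ωl * r ^ 2 := by
      rw [show 4 * M * a * m * ω * (a ^ 2 - 3 * r ^ 2) = (4 * M * a) * (m * ω) * (a ^ 2 - 3 * r ^ 2)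
        by ring, abs_mul, abs_mul, abs_of_nonneg (by positivity : (0 : ℝ) ≤ 4 * M * a), abs_mul]
      have h3 : |a ^ 2 - 3 * r ^ 2| ≤ 3 * r ^ 2 := by
        rw [abs_sub_comm, abs_of_nonneg (by nlinarith)]; nlinarith [sq_nonneg a]
      have hmω : |(m : ℝ)| * |ω| ≤ |(m : ℝ)| * ωl := mul_le_mul_of_nonneg_left hω (abs_nonneg _)
      have h4 : 0 ≤ 4 * M * a := by positivity
      calc 4 * M * a * (|(m : ℝ)| * |ω|) * |a ^ 2 - 3 * r ^ 2|
          ≤ 4 * M * a * (|(m : ℝ)| * ωl) * (3 * r ^ 2) :=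
            mul_le_mul (mul_le_mul_of_nonneg_left hmω h4) h3 (abs_nonneg _) (by positivity)
        _ = 12 * M * a * |(m : ℝ)| * ωl * r ^ 2 := by ring
    have h2 : |4 * r * a ^ 2 * (m : ℝ) ^ 2| = 4 * r * a ^ 2 * (m : ℝ) ^ 2 := abs_of_nonneg (by positivity)
    linarith
  have hden : r ^ 6 ≤ (r ^ 2 + a ^ 2) ^ 3 := by
    have : r ^ 2 ≤ r ^ 2 + a ^ 2 := by nlinarith [sq_nonneg a]
    calc r ^ 6 = (r ^ 2) ^ 3 := by ring
      _ ≤ (r ^ 2 + a ^ 2) ^ 3 := by gcongr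
  calc |4 * M * a * m * ω * (a ^ 2 - 3 * r ^ 2) + 4 * r * a ^ 2 * (m : ℝ) ^ 2| / (r ^ 2 + a ^ 2) ^ 3
      ≤ (12 * M * a * |(m : ℝ)| * ωl * r ^ 2 + 4 * r * a ^ 2 * (m : ℝ) ^ 2) / (r ^ 2 + a ^ 2) ^ 3 := by
        gcongr
    _ ≤ (12 * M * a * |(m : ℝ)| * ωl * r ^ 2 + 4 * r * a ^ 2 * (m : ℝ) ^ 2) / r ^ 6 := by
        apply div_le_div_of_nonneg_left (by positivity) (by positivity) hden

/-! ### Small-`a` uniform bounds (`0 ≤ a`, `2a ≤ M`) -/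

section SmallA

variable {M a : ℝ}

/-- `√(M² − a²) ≥ (43/50)M` for `2a ≤ M`, `0 ≤ a` (`M² − a² ≥ 3M²/4 ≥ (43M/50)²`). [folklore] -/
theorem sqrt_ge_smallA (hM : 0 ≤ M) (ha0 : 0 ≤ a) (ha2 : 2 * a ≤ M) :
    43 / 50 * M ≤ √(M ^ 2 - a ^ 2) := by
  rw [show (43 : ℝ) / 50 * M = √((43 / 50 * M) ^ 2) by rw [Real.sqrt_sq (by positivity)]]
  exact Real.sqrt_le_sqrt (by nlinarith)

/-- `r₊ ≥ (93/50)M` for `2a ≤ M`. [folklore] -/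
theorem rPlus_ge_smallA (hM : 0 ≤ M) (ha0 : 0 ≤ a) (ha2 : 2 * a ≤ M) :
    93 / 50 * M ≤ rPlus M a := by
  unfold rPlus; linarith [sqrt_ge_smallA hM ha0 ha2]

/-- `r₊ ≤ 2M` (`0 ≤ M`); a local copy of `KerrHyperboloidalLeaves.rPlus_le_two_mul` (not imported
here to keep the import chain of the separated analysis light). [folklore] -/
theorem rPlus_le_two_mul_smallA (hM : 0 ≤ M) (a : ℝ) : rPlus M a ≤ 2 * M := by
  unfold rPlus
  have : √(M ^ 2 - a ^ 2) ≤ M := by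
    rw [Real.sqrt_le_left hM]; nlinarith [sq_nonneg a]
  linarith

/-- `r₊ − r₋ ≥ (43/25)M` for `2a ≤ M`. [folklore] -/
theorem rPlus_sub_rMinus_ge_smallA (hM : 0 ≤ M) (ha0 : 0 ≤ a) (ha2 : 2 * a ≤ M) :
    43 / 25 * M ≤ rPlus M a - rMinus M a := by
  unfold rPlus rMinus; linarith [sqrt_ge_smallA hM ha0 ha2]

/-- `r₊² − a² ≥ 3M²` for `2a ≤ M`. [folklore] -/
theorem rPlus_sq_sub_sq_ge_smallA (hM : 0 ≤ M) (ha0 : 0 ≤ a) (ha2 : 2 * a ≤ M) :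
    3 * M ^ 2 ≤ rPlus M a ^ 2 - a ^ 2 := by
  have h := rPlus_ge_smallA hM ha0 ha2
  nlinarith

/-- **`κ_H ≥ 1/(14M³)` for `2a ≤ M`** (`0 < M`, `0 ≤ a`): each factor of
`κ_H = 4Mr₊(r₊ − M)(r₊² − a²)/(r₊² + a²)⁴` bounded using `r₊ ∈ [93M/50, 2M]`,
`r₊ − M ≥ 43M/50`, `r₊² − a² ≥ 3M²`, `r₊² + a² = 2Mr₊ ≤ 4M²`. [folklore] -/
theorem horizonSlope_ge_smallA (hM : 0 < M) (ha0 : 0 ≤ a) (ha2 : 2 * a ≤ M) :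
    1 / (14 * M ^ 3) ≤ horizonSlope M a := by
  have haM : |a| ≤ M := by rw [abs_of_nonneg ha0]; linarith
  have h1 := rPlus_ge_smallA hM.le ha0 ha2
  have h2 := rPlus_le_two_mul_smallA hM.le a
  have hrp0 : 0 < rPlus M a := by linarith
  have h3 : 43 / 50 * M ≤ rPlus M a - M := by unfold rPlus; linarith [sqrt_ge_smallA hM.le ha0 ha2]
  have h30 : 0 ≤ rPlus M a - M := by linarith
  have h4 := rPlus_sq_sub_sq_ge_smallA hM.le ha0 ha2
  have h40 : 0 ≤ rPlus M a ^ 2 - a ^ 2 := by linarith [sq_nonneg M]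
  have h5 : (rPlus M a ^ 2 + a ^ 2) ^ 4 ≤ (4 * M ^ 2) ^ 4 := by
    rw [rPlus_sq_add_sq haM]
    have : 2 * M * rPlus M a ≤ 4 * M ^ 2 := by nlinarith
    exact pow_le_pow_left₀ (by positivity) this 4
  unfold horizonSlope
  rw [div_le_div_iff₀ (by positivity) (by positivity)]
  have hnum : 4 * M * (93 / 50 * M) * (43 / 50 * M) * (3 * M ^ 2) ≤
      4 * M * rPlus M a * (rPlus M a - M) * (rPlus M a ^ 2 - a ^ 2) := by
    have s1 : 4 * M * (93 / 50 * M) ≤ 4 * M * rPlus M a :=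
      mul_le_mul_of_nonneg_left h1 (by positivity)
    have s2 : 4 * M * (93 / 50 * M) * (43 / 50 * M) ≤ 4 * M * rPlus M a * (rPlus M a - M) :=
      mul_le_mul s1 h3 (by positivity) (by positivity)
    exact mul_le_mul s2 h4 (by positivity) (mul_nonneg (by positivity) h30)
  calc 1 * (rPlus M a ^ 2 + a ^ 2) ^ 4 ≤ (4 * M ^ 2) ^ 4 := by linarith
    _ ≤ 4 * M * (93 / 50 * M) * (43 / 50 * M) * (3 * M ^ 2) * (14 * M ^ 3) := by
        have e1 : (4 * M ^ 2) ^ 4 = 256 * M ^ 8 := by ring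
        have e2 : 4 * M * (93 / 50 * M) * (43 / 50 * M) * (3 * M ^ 2) * (14 * M ^ 3) =
            671832 / 2500 * M ^ 8 := by ring
        rw [e1, e2]
        nlinarith [pow_pos hM 8]
    _ ≤ 4 * M * rPlus M a * (rPlus M a - M) * (rPlus M a ^ 2 - a ^ 2) * (14 * M ^ 3) := by
        gcongr

/-- `L(Λ₁) ≤ (216Λ₁ + 2896)/M⁴·` more precisely `horizonCurv M a Λ₁ ≤ 216Λ₁/M⁴ + 2896/M⁴`
(`r₊ ≥ M`, `Λ₁ ≥ 0`). [folklore] -/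
theorem horizonCurv_le (hM : 0 < M) {Λ₁ : ℝ} (hΛ₁ : 0 ≤ Λ₁) :
    horizonCurv M a Λ₁ ≤ 216 * Λ₁ / M ^ 4 + 2896 / M ^ 4 := by
  have hrpM : M ≤ rPlus M a := M_le_rPlus M a
  have hrp0 : 0 < rPlus M a := hM.trans_le hrpM
  unfold horizonCurv
  have h1 : 216 * Λ₁ / rPlus M a ^ 4 ≤ 216 * Λ₁ / M ^ 4 := by
    apply div_le_div_of_nonneg_left (by positivity) (by positivity); gcongr
  have h2 : 2896 * M / rPlus M a ^ 5 ≤ 2896 / M ^ 4 := by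
    rw [div_le_div_iff₀ (by positivity) (by positivity)]
    have : M ^ 5 ≤ rPlus M a ^ 5 := by gcongr
    nlinarith
  linarith

end SmallA

/-! ### The far region -/

/-- The `Δ`-part with slack: `(8/5)(r² + a²)² ≤ 2r(r³ + a²r − 3Mr² + Ma²)` for `r ≥ 20M`, `|a| ≤ M`.
[folklore] -/
theorem axi_far_delta_part' {M a r : ℝ} (hM : 0 < M) (haM : |a| ≤ M) (hr : 20 * M ≤ r) :
    8 / 5 * (r ^ 2 + a ^ 2) ^ 2 ≤ 2 * r * (r ^ 3 + a ^ 2 * r - 3 * M * r ^ 2 + M * a ^ 2) := by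
  have hr0 : 0 < r := by linarith
  have ha2 : a ^ 2 ≤ M ^ 2 := by nlinarith [sq_abs a, abs_nonneg a]
  have hM2 : 400 * M ^ 2 ≤ r ^ 2 := by nlinarith
  have e1 : 6 * M * r ^ 3 ≤ 6 / 20 * r ^ 4 := by nlinarith [pow_pos hr0 3]
  have e2 : a ^ 2 * r ^ 2 ≤ r ^ 4 / 400 := by nlinarith [pow_pos hr0 2]
  have e3 : a ^ 4 ≤ r ^ 4 / 160000 := by
    have : a ^ 2 ≤ r ^ 2 / 400 := by nlinarith
    nlinarith [sq_nonneg a]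
  nlinarith [mul_nonneg (mul_nonneg hM.le (sq_nonneg a)) hr0.le]

/-- The `V₁`-part with slack: `(8/5)(a²Δ + 2Mr(r² − a²))(r² + a²)² ≤ r·(−P₁)` for `r ≥ 20M`,
`|a| ≤ M`. [folklore] -/
theorem axi_far_V₁_part' {M a r : ℝ} (hM : 0 < M) (haM : |a| ≤ M) (hr : 20 * M ≤ r) :
    8 / 5 * ((a ^ 2 * delta M a r + 2 * M * r * (r ^ 2 - a ^ 2)) * (r ^ 2 + a ^ 2) ^ 2) ≤
      r * (-critPoly₁ M a r) := by
  have hr0 : 0 < r := by linarith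
  have ha2 : a ^ 2 ≤ M ^ 2 := by nlinarith [sq_abs a, abs_nonneg a]
  have ha4 : a ^ 4 ≤ M ^ 4 := by nlinarith
  have ha6 : a ^ 6 ≤ M ^ 6 := by
    calc a ^ 6 = a ^ 4 * a ^ 2 := by ring
      _ ≤ M ^ 4 * M ^ 2 := mul_le_mul ha4 ha2 (sq_nonneg a) (by positivity)
      _ = M ^ 6 := by ring
  have ha8 : a ^ 8 ≤ M ^ 8 := by
    calc a ^ 8 = (a ^ 4) ^ 2 := by ring
      _ ≤ (M ^ 4) ^ 2 := pow_le_pow_left₀ (by positivity) ha4 2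
      _ = M ^ 8 := by ring
  have hM20 : M ≤ r / 20 := by linarith
  have key : r * (-critPoly₁ M a r) -
      8 / 5 * ((a ^ 2 * delta M a r + 2 * M * r * (r ^ 2 - a ^ 2)) * (r ^ 2 + a ^ 2) ^ 2) =
      14 / 5 * M * r ^ 7 - (16 * M ^ 2 - 12 / 5 * a ^ 2) * r ^ 6 - 30 * M * a ^ 2 * r ^ 5 +
        (64 * M ^ 2 * a ^ 2 + 16 / 5 * a ^ 4) * r ^ 4 - 102 / 5 * M * a ^ 4 * r ^ 3 -
        (16 * M ^ 2 * a ^ 4 + 4 / 5 * a ^ 6) * r ^ 2 + 62 / 5 * M * a ^ 6 * r - 8 / 5 * a ^ 8 := by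
    unfold critPoly₁ delta
    ring
  rw [← sub_nonneg, key]
  have e1 : M ^ 2 * r ^ 6 ≤ M * r ^ 7 / 20 := by
    calc M ^ 2 * r ^ 6 = M * r ^ 6 * M := by ring
      _ ≤ M * r ^ 6 * (r / 20) := by gcongr
      _ = M * r ^ 7 / 20 := by ring
  have e2 : M ^ 3 * r ^ 5 ≤ M * r ^ 7 / 400 := by
    calc M ^ 3 * r ^ 5 = M * r ^ 5 * (M * M) := by ring
      _ ≤ M * r ^ 5 * (r / 20 * (r / 20)) := by gcongr
      _ = M * r ^ 7 / 400 := by ring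
  have e3 : M ^ 5 * r ^ 3 ≤ M * r ^ 7 / 160000 := by
    calc M ^ 5 * r ^ 3 = M * r ^ 3 * (M * M * M * M) := by ring
      _ ≤ M * r ^ 3 * (r / 20 * (r / 20) * (r / 20) * (r / 20)) := by gcongr
      _ = M * r ^ 7 / 160000 := by ring
  have e4 : M ^ 6 * r ^ 2 ≤ M * r ^ 7 / 3200000 := by
    calc M ^ 6 * r ^ 2 = M * r ^ 2 * (M * M * M * M * M) := by ring
      _ ≤ M * r ^ 2 * (r / 20 * (r / 20) * (r / 20) * (r / 20) * (r / 20)) := by gcongr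
      _ = M * r ^ 7 / 3200000 := by ring
  have e5 : M ^ 8 ≤ M * r ^ 7 / 1280000000 := by
    calc M ^ 8 = M * (M * M * M * M * M * M * M) := by ring
      _ ≤ M * (r / 20 * (r / 20) * (r / 20) * (r / 20) * (r / 20) * (r / 20) * (r / 20)) := by
          gcongr
      _ = M * r ^ 7 / 1280000000 := by ring
  have f1 : M * a ^ 2 * r ^ 5 ≤ M ^ 3 * r ^ 5 := by
    calc M * a ^ 2 * r ^ 5 = M * r ^ 5 * a ^ 2 := by ring
      _ ≤ M * r ^ 5 * M ^ 2 := by gcongr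
      _ = M ^ 3 * r ^ 5 := by ring
  have f2 : M * a ^ 4 * r ^ 3 ≤ M ^ 5 * r ^ 3 := by
    calc M * a ^ 4 * r ^ 3 = M * r ^ 3 * a ^ 4 := by ring
      _ ≤ M * r ^ 3 * M ^ 4 := by gcongr
      _ = M ^ 5 * r ^ 3 := by ring
  have f3 : M ^ 2 * a ^ 4 * r ^ 2 ≤ M ^ 6 * r ^ 2 := by
    calc M ^ 2 * a ^ 4 * r ^ 2 = M ^ 2 * r ^ 2 * a ^ 4 := by ring
      _ ≤ M ^ 2 * r ^ 2 * M ^ 4 := by gcongr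
      _ = M ^ 6 * r ^ 2 := by ring
  have f4 : a ^ 6 * r ^ 2 ≤ M ^ 6 * r ^ 2 := by gcongr
  have g1 : 0 ≤ a ^ 2 * r ^ 6 := by positivity
  have g2 : 0 ≤ (64 * M ^ 2 * a ^ 2 + 16 / 5 * a ^ 4) * r ^ 4 := by positivity
  have g3 : 0 ≤ M * a ^ 6 * r := by positivity
  have hMr7 : 0 < M * r ^ 7 := by positivity
  nlinarith [e1, e2, e3, e4, e5, f1, f2, f3, f4, g1, g2, g3, ha8]

/-- **The axisymmetric far-region ratio with slack**: `(8/5)V_axi ≤ r·(Δ/(r² + a²))·(−dV_axi/dr)`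
for `r ≥ 20M` (`V_axi` the `m = 0` potential, any `Λ ≥ 0`). [cite: DafermosRodnianskiShlapentokhrothman2014, Prop. 8.7.1 (proof)] -/
theorem sepPotential_axi_far_ratio' {M a ω Λ r : ℝ} (hM : 0 < M) (haM : |a| ≤ M) (hΛ : 0 ≤ Λ)
    (hr : 20 * M ≤ r) :
    8 / 5 * sepPotential M a ω 0 Λ r ≤
      r * (delta M a r / (r ^ 2 + a ^ 2)) * (-deriv (sepPotential M a ω 0 Λ) r) := by
  have hr0 : 0 < r := by linarith
  have hD : 0 < r ^ 2 + a ^ 2 := by positivity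
  have hrp : rPlus M a ≤ r := by linarith [rPlus_le_two_mul_smallA hM.le a]
  have hΔ0 : 0 ≤ delta M a r := delta_nonneg haM hrp
  rw [deriv_sepPotential_eq M a ω 0 Λ hD.ne', critPoly_axi_eq, sepPotential_axi_eq,
    sepPotential₁_eq M a hD.ne']
  have hA := axi_far_delta_part' hM haM hr
  have hB := axi_far_V₁_part' hM haM hr
  have hpartD : 8 / 5 * (Λ * (delta M a r / (r ^ 2 + a ^ 2) ^ 2)) ≤
      r * (delta M a r / (r ^ 2 + a ^ 2)) *
        (-(-2 * Λ * (r ^ 3 + a ^ 2 * r - 3 * M * r ^ 2 + M * a ^ 2) / (r ^ 2 + a ^ 2) ^ 3)) := by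
    have hΛΔ : 0 ≤ Λ * delta M a r := mul_nonneg hΛ hΔ0
    rw [show 8 / 5 * (Λ * (delta M a r / (r ^ 2 + a ^ 2) ^ 2)) =
        Λ * delta M a r * (8 / 5 * (r ^ 2 + a ^ 2) ^ 2) / (r ^ 2 + a ^ 2) ^ 4 by
          field_simp,
      show r * (delta M a r / (r ^ 2 + a ^ 2)) *
          (-(-2 * Λ * (r ^ 3 + a ^ 2 * r - 3 * M * r ^ 2 + M * a ^ 2) / (r ^ 2 + a ^ 2) ^ 3)) =
        Λ * delta M a r * (2 * r * (r ^ 3 + a ^ 2 * r - 3 * M * r ^ 2 + M * a ^ 2)) /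
          (r ^ 2 + a ^ 2) ^ 4 by
          field_simp]
    rw [div_le_div_iff_of_pos_right (by positivity)]
    exact mul_le_mul_of_nonneg_left hA hΛΔ
  have hpart1 : 8 / 5 * (delta M a r / (r ^ 2 + a ^ 2) ^ 4 *
      (a ^ 2 * delta M a r + 2 * M * r * (r ^ 2 - a ^ 2))) ≤
      r * (delta M a r / (r ^ 2 + a ^ 2)) * (-(critPoly₁ M a r / (r ^ 2 + a ^ 2) ^ 5)) := by
    rw [show 8 / 5 * (delta M a r / (r ^ 2 + a ^ 2) ^ 4 *
        (a ^ 2 * delta M a r + 2 * M * r * (r ^ 2 - a ^ 2))) =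
        delta M a r * (8 / 5 * ((a ^ 2 * delta M a r + 2 * M * r * (r ^ 2 - a ^ 2)) *
          (r ^ 2 + a ^ 2) ^ 2)) / (r ^ 2 + a ^ 2) ^ 6 by
          field_simp,
      show r * (delta M a r / (r ^ 2 + a ^ 2)) * (-(critPoly₁ M a r / (r ^ 2 + a ^ 2) ^ 5)) =
        delta M a r * (r * (-critPoly₁ M a r)) / (r ^ 2 + a ^ 2) ^ 6 by
          field_simp]
    rw [div_le_div_iff_of_pos_right (by positivity)]
    exact mul_le_mul_of_nonneg_left hB hΔ0
  have hsum := add_le_add hpartD hpart1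
  have e : r * (delta M a r / (r ^ 2 + a ^ 2)) *
      -(-2 * Λ * (r ^ 3 + a ^ 2 * r - 3 * M * r ^ 2 + M * a ^ 2) / (r ^ 2 + a ^ 2) ^ 3 +
        critPoly₁ M a r / (r ^ 2 + a ^ 2) ^ 5) =
      r * (delta M a r / (r ^ 2 + a ^ 2)) *
        (-(-2 * Λ * (r ^ 3 + a ^ 2 * r - 3 * M * r ^ 2 + M * a ^ 2) / (r ^ 2 + a ^ 2) ^ 3)) +
      r * (delta M a r / (r ^ 2 + a ^ 2)) * (-(critPoly₁ M a r / (r ^ 2 + a ^ 2) ^ 5)) := by ring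
  rw [mul_add, e]
  exact hsum

/-- `ΛΔ/(r² + a²)² ≥ (7/8)Λ/r²` for `r ≥ 20M`, `|a| ≤ M`, `Λ ≥ 0`. [folklore] -/
theorem axi_D_ge_far {M a Λ r : ℝ} (hM : 0 < M) (haM : |a| ≤ M) (hΛ : 0 ≤ Λ) (hr : 20 * M ≤ r) :
    7 / 8 * Λ / r ^ 2 ≤ Λ * (delta M a r / (r ^ 2 + a ^ 2) ^ 2) := by
  have hr0 : 0 < r := by linarith
  have ha2 : a ^ 2 ≤ M ^ 2 := by nlinarith [sq_abs a, abs_nonneg a]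
  have h1 : 7 / 8 / r ^ 2 ≤ delta M a r / (r ^ 2 + a ^ 2) ^ 2 := by
    rw [div_le_div_iff₀ (by positivity) (by positivity)]
    unfold delta
    have hM2 : 400 * M ^ 2 ≤ r ^ 2 := by nlinarith
    have e1 : 2 * M * r ^ 3 ≤ r ^ 4 / 10 := by nlinarith [pow_pos hr0 3]
    have e2 : a ^ 2 * r ^ 2 ≤ r ^ 4 / 400 := by nlinarith [pow_pos hr0 2]
    have e3 : a ^ 4 ≤ r ^ 4 / 160000 := by
      have : a ^ 2 ≤ r ^ 2 / 400 := by nlinarith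
      nlinarith [sq_nonneg a]
    nlinarith [sq_nonneg a, pow_pos hr0 4]
  have := mul_le_mul_of_nonneg_left h1 hΛ
  calc 7 / 8 * Λ / r ^ 2 = Λ * (7 / 8 / r ^ 2) := by ring
    _ ≤ Λ * (delta M a r / (r ^ 2 + a ^ 2) ^ 2) := this

/-- **The perturbation is dominated far out**: for `r ≥ 20M`, `0 ≤ a`, `2a ≤ M`, `|ω| ≤ ω_l`,
`20aω_l ≤ 1` and an admissible triple,
`(3/2)|P| + r|dP/dr| ≤ (1/10)·ΛΔ/(r² + a²)²`. [folklore] -/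
theorem pert_far_dominated {M a ω ωl Λ r : ℝ} {m : ℤ} (hM : 0 < M) (ha0 : 0 ≤ a) (ha2 : 2 * a ≤ M)
    (hadm : IsAdmissibleTriple a ω m Λ) (hω : |ω| ≤ ωl) (hsmall : 20 * (a * ωl) ≤ 1)
    (hr : 20 * M ≤ r) :
    3 / 2 * |pertPotential M a ω m r| + r * |pertPotentialDeriv M a ω m r| ≤
      1 / 10 * (Λ * (delta M a r / (r ^ 2 + a ^ 2) ^ 2)) := by
  have hr0 : 0 < r := by linarith
  have haM : |a| ≤ M := by rw [abs_of_nonneg ha0]; linarith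
  have har : a ≤ r := by linarith
  have hωl : 0 ≤ ωl := (abs_nonneg ω).trans hω
  have hΛ := hadm.nonneg
  have hm2 : (m : ℝ) ^ 2 ≤ Λ := hadm.sq_le
  set μ := |(m : ℝ)| with hμ
  have hμ0 : 0 ≤ μ := abs_nonneg _
  have hμ2 : μ ^ 2 = (m : ℝ) ^ 2 := sq_abs _
  -- `|m| ≤ m²` for an integer `m`
  have hμμ : μ ≤ μ ^ 2 := by
    rcases eq_or_ne m 0 with h | h
    · simp [hμ, h]
    · have : (1 : ℝ) ≤ μ := by
        rw [hμ, ← Int.cast_abs]; exact_mod_cast Int.one_le_abs h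
      nlinarith
  have hP := abs_pertPotential_le (m := m) hM.le ha0 hr0 hω
  have hP' := abs_pertPotentialDeriv_le (m := m) hM.le ha0 hr0 har hω
  have hD := axi_D_ge_far hM haM hΛ hr
  rw [← hμ] at hP hP'
  -- reduce to a polynomial inequality in `μ = |m|`, `m²`, `a ωl`, `a²`
  have hL : 3 / 2 * |pertPotential M a ω m r| + r * |pertPotentialDeriv M a ω m r| ≤
      (18 * M * r * (a * ωl) * μ + 11 / 2 * a ^ 2 * (m : ℝ) ^ 2) / r ^ 4 := by
    have e : (18 * M * r * (a * ωl) * μ + 11 / 2 * a ^ 2 * (m : ℝ) ^ 2) / r ^ 4 =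
        3 / 2 * ((4 * M * r * a * μ * ωl + a ^ 2 * (m : ℝ) ^ 2) / r ^ 4) +
        r * ((12 * M * a * μ * ωl * r ^ 2 + 4 * r * a ^ 2 * (m : ℝ) ^ 2) / r ^ 6) := by
      field_simp; ring
    rw [e]
    have h1 := mul_le_mul_of_nonneg_left hP (by norm_num : (0 : ℝ) ≤ 3 / 2)
    have h2 := mul_le_mul_of_nonneg_left hP' hr0.le
    linarith
  refine hL.trans (le_trans ?_ (mul_le_mul_of_nonneg_left hD (by norm_num)))
  -- (18 M r (aωl) μ + 5.5 a² m²)/r⁴ ≤ (1/10)(7/8) Λ/r², using μ ≤ m² ≤ Λ, aωl ≤ 1/20, a² ≤ M²/4, M ≤ r/20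
  rw [show 1 / 10 * (7 / 8 * Λ / r ^ 2) = 7 / 80 * Λ * r ^ 2 / r ^ 4 by field_simp; ring]
  rw [div_le_div_iff_of_pos_right (by positivity)]
  rw [hμ2] at hμμ
  have h1 : 18 * M * r * (a * ωl) * μ ≤ 9 / 200 * (m : ℝ) ^ 2 * r ^ 2 := by
    have s1 : 18 * M * r * (a * ωl) * μ ≤ 18 * M * r * (1 / 20) * μ := by
      have : a * ωl ≤ 1 / 20 := by linarith
      have h0 : 0 ≤ 18 * M * r * μ := by positivity
      nlinarith [mul_le_mul_of_nonneg_right this h0]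
    have s2 : M * r * μ ≤ r ^ 2 / 20 * (m : ℝ) ^ 2 := by
      have : M * r ≤ r ^ 2 / 20 := by nlinarith
      exact mul_le_mul this hμμ hμ0 (by positivity)
    nlinarith
  have h2 : 11 / 2 * a ^ 2 * (m : ℝ) ^ 2 ≤ 11 / 2 / 1600 * (m : ℝ) ^ 2 * r ^ 2 := by
    have : a ^ 2 ≤ r ^ 2 / 1600 := by nlinarith
    nlinarith [mul_le_mul_of_nonneg_left this (by positivity : (0 : ℝ) ≤ (m : ℝ) ^ 2)]
  nlinarith [mul_le_mul_of_nonneg_right hm2 (by positivity : (0 : ℝ) ≤ r ^ 2)]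

/-- **The far-region decay property for `m ≠ 0`, small `a`** (DRSR arXiv:1402.7034, proof of
Prop. 8.7.1, second bullet and the choice of `R₂*`): for `r ≥ 20M`, `0 ≤ a`, `2a ≤ M`,
`|ω| ≤ ω_l`, `20aω_l ≤ 1`, admissible `(ω, m, Λ)`:
`(3/2)V(r) ≤ r·(Δ/(r² + a²))·(−dV/dr)(r)`. [cite: DafermosRodnianskiShlapentokhrothman2014, Prop. 8.7.1 (proof)] -/
theorem sepPotential_far_ratio_smallA {M a ω ωl Λ r : ℝ} {m : ℤ} (hM : 0 < M) (ha0 : 0 ≤ a)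
    (ha2 : 2 * a ≤ M) (hadm : IsAdmissibleTriple a ω m Λ) (hω : |ω| ≤ ωl)
    (hsmall : 20 * (a * ωl) ≤ 1) (hr : 20 * M ≤ r) :
    3 / 2 * sepPotential M a ω m Λ r ≤
      r * (delta M a r / (r ^ 2 + a ^ 2)) * (-deriv (sepPotential M a ω m Λ) r) := by
  have hr0 : 0 < r := by linarith
  have haM : |a| ≤ M := by rw [abs_of_nonneg ha0]; linarith
  have hΛ := hadm.nonneg
  have hD0 : 0 < r ^ 2 + a ^ 2 := by positivity
  have hrp : rPlus M a ≤ r := by linarith [rPlus_le_two_mul_smallA hM.le a]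
  have hq : 0 ≤ delta M a r / (r ^ 2 + a ^ 2) := div_nonneg (delta_nonneg haM hrp) hD0.le
  have hq1 : delta M a r / (r ^ 2 + a ^ 2) ≤ 1 := by
    rw [div_le_one hD0]; unfold delta; nlinarith
  have hratio := sepPotential_axi_far_ratio' (ω := ω) hM haM hΛ hr
  have hpert := pert_far_dominated hM ha0 ha2 hadm hω hsmall hr
  have hVaxi : Λ * (delta M a r / (r ^ 2 + a ^ 2) ^ 2) ≤ sepPotential M a ω 0 Λ r := by
    rw [sepPotential_axi_eq]
    linarith [sepPotential₁_nonneg haM hrp]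
  rw [sepPotential_eq_axi_add_pert, deriv_sepPotential_eq_axi_add_pert M a ω m Λ hD0.ne']
  have hP := le_abs_self (pertPotential M a ω m r)
  have hP' := neg_abs_le (pertPotentialDeriv M a ω m r)
  -- r q (−P') ≥ −r |P'|
  have h1 : -(r * |pertPotentialDeriv M a ω m r|) ≤
      r * (delta M a r / (r ^ 2 + a ^ 2)) * (-pertPotentialDeriv M a ω m r) := by
    have h2 : |delta M a r / (r ^ 2 + a ^ 2) * pertPotentialDeriv M a ω m r| ≤
        |pertPotentialDeriv M a ω m r| := by
      rw [abs_mul, abs_of_nonneg hq]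
      exact mul_le_of_le_one_left (abs_nonneg _) hq1
    have h3 : delta M a r / (r ^ 2 + a ^ 2) * pertPotentialDeriv M a ω m r ≤
        |pertPotentialDeriv M a ω m r| := (le_abs_self _).trans h2
    have h4 := mul_le_mul_of_nonneg_left h3 hr0.le
    have e : r * (delta M a r / (r ^ 2 + a ^ 2)) * (-pertPotentialDeriv M a ω m r) =
        -(r * (delta M a r / (r ^ 2 + a ^ 2) * pertPotentialDeriv M a ω m r)) := by ring
    rw [e]
    linarith
  have h2 : 3 / 2 * pertPotential M a ω m r ≤ 3 / 2 * |pertPotential M a ω m r| := by linarith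
  nlinarith

/-- Far out the perturbation is below the `Δ`-part: `|P| ≤ ΛΔ/(r² + a²)²` for `r ≥ 20M` (small `a`).
[folklore] -/
theorem abs_pert_le_axi_far {M a ω ωl Λ r : ℝ} {m : ℤ} (hM : 0 < M) (ha0 : 0 ≤ a) (ha2 : 2 * a ≤ M)
    (hadm : IsAdmissibleTriple a ω m Λ) (hω : |ω| ≤ ωl) (hsmall : 20 * (a * ωl) ≤ 1)
    (hr : 20 * M ≤ r) :
    |pertPotential M a ω m r| ≤ Λ * (delta M a r / (r ^ 2 + a ^ 2) ^ 2) := by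
  have hr0 : 0 < r := by linarith
  have h := pert_far_dominated hM ha0 ha2 hadm hω hsmall hr
  have haM : |a| ≤ M := by rw [abs_of_nonneg ha0]; linarith
  have hrp : rPlus M a ≤ r := by linarith [rPlus_le_two_mul_smallA hM.le a]
  have hD : 0 ≤ Λ * (delta M a r / (r ^ 2 + a ^ 2) ^ 2) :=
    mul_nonneg hadm.nonneg (div_nonneg (delta_nonneg haM hrp) (by positivity))
  nlinarith [abs_nonneg (pertPotentialDeriv M a ω m r), abs_nonneg (pertPotential M a ω m r)]

/-- **`V ≥ V₁ ≥ M/(2r³)` and `V > 0` far out** (`r ≥ 20M`, small `a`). [folklore] -/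
theorem sepPotential_ge_smallA_far {M a ω ωl Λ r : ℝ} {m : ℤ} (hM : 0 < M) (ha0 : 0 ≤ a)
    (ha2 : 2 * a ≤ M) (hadm : IsAdmissibleTriple a ω m Λ) (hω : |ω| ≤ ωl)
    (hsmall : 20 * (a * ωl) ≤ 1) (hr : 20 * M ≤ r) :
    M / (2 * r ^ 3) ≤ sepPotential M a ω m Λ r := by
  have haM : |a| ≤ M := by rw [abs_of_nonneg ha0]; linarith
  have hP := abs_pert_le_axi_far hM ha0 ha2 hadm hω hsmall hr
  have hP' := neg_abs_le (pertPotential M a ω m r)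
  rw [sepPotential_eq_axi_add_pert, sepPotential_axi_eq]
  have h1 := sepPotential₁_ge_of_four_mul_le hM haM (show 4 * M ≤ r by linarith)
  linarith

/-! ### Near the horizon -/

/-- **`dV/dr(r₊) ≥ κ_H` for small `a`** (DRSR arXiv:1402.7034, proof of Prop. 8.7.1, third bullet
"for sufficiently small `ã₀` and sufficiently negative `r*`, `V' > 0`"): for `0 ≤ a`, `2a ≤ M`,
`|ω| ≤ ω_l`, `20aω_l ≤ 1` and an admissible triple, `dV₀/dr(r₊) ≥ 0` — in
`(r₊² + a²)³ dV₀/dr(r₊) = 4maMω(a² − 3r₊²) + 4r₊a²m² + 2(r₊² + a²)(r₊ − M)Λ` the last term dominates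
the first since `Λ ≥ |m|` and `r₊ − M = √(M² − a²) ≥ 6Maω_l` — hence `dV/dr(r₊) ≥ dV₁/dr(r₊) = κ_H`.
[cite: DafermosRodnianskiShlapentokhrothman2014, Prop. 8.7.1 (proof)] -/
theorem deriv_sepPotential_rPlus_ge_smallA {M a ω ωl Λ : ℝ} {m : ℤ} (hM : 0 < M) (ha0 : 0 ≤ a)
    (ha2 : 2 * a ≤ M) (hadm : IsAdmissibleTriple a ω m Λ) (hω : |ω| ≤ ωl)
    (hsmall : 20 * (a * ωl) ≤ 1) :
    horizonSlope M a ≤ deriv (sepPotential M a ω m Λ) (rPlus M a) := by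
  have haM : |a| ≤ M := by rw [abs_of_nonneg ha0]; linarith
  have hωl : 0 ≤ ωl := (abs_nonneg ω).trans hω
  have h0 := hasDerivAt_sepPotential₀_rPlus haM hM ω m Λ
  have h1' := hasDerivAt_sepPotential₁_rPlus haM hM
  have hsum : HasDerivAt (sepPotential M a ω m Λ) _ (rPlus M a) := h0.add h1'
  rw [hsum.deriv, ← h1'.deriv, deriv_sepPotential₁_rPlus_eq haM hM]
  have hrp := rPlus_ge_smallA hM.le ha0 ha2
  have hrp0 : 0 < rPlus M a := by linarith
  have hrM : 43 / 50 * M ≤ rPlus M a - M := by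
    unfold rPlus; linarith [sqrt_ge_smallA hM.le ha0 ha2]
  have hΛ := hadm.nonneg
  set μ := |(m : ℝ)| with hμ
  have hμ0 : 0 ≤ μ := abs_nonneg _
  have hμΛ : μ ≤ Λ := by
    have h1 := hadm.1
    rw [← hμ] at h1
    nlinarith
  -- the numerator of dV₀/dr(r₊) is ≥ 0
  have hnum : 0 ≤ 4 * m * a * M * ω * (-3 * rPlus M a ^ 2 + a ^ 2) +
      4 * rPlus M a * a ^ 2 * (m : ℝ) ^ 2 +
      2 * (rPlus M a ^ 2 + a ^ 2) * (rPlus M a - M) * Λ := by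
    have hA : |4 * m * a * M * ω * (-3 * rPlus M a ^ 2 + a ^ 2)| ≤
        12 * M * (a * ωl) * μ * rPlus M a ^ 2 := by
      rw [show 4 * m * a * M * ω * (-3 * rPlus M a ^ 2 + a ^ 2) =
        (4 * a * M) * (m * ω) * (-3 * rPlus M a ^ 2 + a ^ 2) by ring, abs_mul, abs_mul,
        abs_of_nonneg (by positivity : (0 : ℝ) ≤ 4 * a * M), abs_mul, ← hμ]
      have h3 : |-3 * rPlus M a ^ 2 + a ^ 2| ≤ 3 * rPlus M a ^ 2 := by
        rw [abs_le]; constructor <;> nlinarith [sq_nonneg a, sq_nonneg (rPlus M a)]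
      have hmω : μ * |ω| ≤ μ * ωl := mul_le_mul_of_nonneg_left hω (abs_nonneg _)
      calc 4 * a * M * (μ * |ω|) * |-3 * rPlus M a ^ 2 + a ^ 2|
          ≤ 4 * a * M * (μ * ωl) * (3 * rPlus M a ^ 2) :=
            mul_le_mul (mul_le_mul_of_nonneg_left hmω (by positivity)) h3 (abs_nonneg _)
              (mul_nonneg (by positivity) (mul_nonneg hμ0 hωl))
        _ = 12 * M * (a * ωl) * μ * rPlus M a ^ 2 := by ring
    have hA' := neg_abs_le (4 * m * a * M * ω * (-3 * rPlus M a ^ 2 + a ^ 2))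
    have hB : 0 ≤ 4 * rPlus M a * a ^ 2 * (m : ℝ) ^ 2 := by positivity
    -- 2(r₊²+a²)(r₊−M)Λ ≥ 2 r₊² (43M/50) μ ≥ 12 M (aωl) μ r₊² as 12 aωl ≤ 12/20 < 2·43/50
    have hC : 12 * M * (a * ωl) * μ * rPlus M a ^ 2 ≤
        2 * (rPlus M a ^ 2 + a ^ 2) * (rPlus M a - M) * Λ := by
      have s1 : 12 * M * (a * ωl) * μ * rPlus M a ^ 2 ≤ 12 / 20 * M * μ * rPlus M a ^ 2 := by
        have : a * ωl ≤ 1 / 20 := by linarith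
        have h0 : 0 ≤ 12 * M * μ * rPlus M a ^ 2 := by
          have := sq_nonneg (rPlus M a); positivity
        nlinarith [mul_le_mul_of_nonneg_left this h0]
      have s2 : 12 / 20 * M * μ * rPlus M a ^ 2 ≤ 2 * rPlus M a ^ 2 * (43 / 50 * M) * μ := by
        nlinarith [mul_nonneg (mul_nonneg hM.le hμ0) (sq_nonneg (rPlus M a))]
      have s3 : 2 * rPlus M a ^ 2 * (43 / 50 * M) * μ ≤
          2 * (rPlus M a ^ 2 + a ^ 2) * (rPlus M a - M) * Λ := by
        have t1 : rPlus M a ^ 2 ≤ rPlus M a ^ 2 + a ^ 2 := by nlinarith [sq_nonneg a]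
        have u1 : 2 * rPlus M a ^ 2 ≤ 2 * (rPlus M a ^ 2 + a ^ 2) := by linarith
        have u2 : 2 * rPlus M a ^ 2 * (43 / 50 * M) ≤ 2 * (rPlus M a ^ 2 + a ^ 2) * (rPlus M a - M) :=
          mul_le_mul u1 hrM (by positivity) (by positivity)
        have u3 := mul_le_mul u2 hμΛ hμ0 (mul_nonneg (by positivity) (by linarith))
        linarith
      linarith
    linarith
  have hV0 : 0 ≤ (4 * m * a * M * ω * (-3 * rPlus M a ^ 2 + a ^ 2) +
      4 * rPlus M a * a ^ 2 * (m : ℝ) ^ 2 +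
      2 * (rPlus M a ^ 2 + a ^ 2) * (rPlus M a - M) * Λ) / (rPlus M a ^ 2 + a ^ 2) ^ 3 :=
    div_nonneg hnum (by positivity)
  unfold horizonSlope
  linarith

/-- **`κ_H/2 ≤ dV/dr ≤ κ₂(Λ)` on `[r₊, r₊ + s]` whenever `s·L(Λ₁) ≤ κ_H/2`** (small `a`, `Λ ≤ Λ₁`):
mean value theorem from `dV/dr(r₊) ≥ κ_H`, `|d²V/dr²| ≤ L`. [cite: DafermosRodnianskiShlapentokhrothman2014, Prop. 8.7.1 (proof)] -/
theorem deriv_sepPotential_near_smallA {M a ω ωl Λ Λ₁ s r : ℝ} {m : ℤ} (hM : 0 < M) (ha0 : 0 ≤ a)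
    (ha2 : 2 * a ≤ M) (hadm : IsAdmissibleTriple a ω m Λ) (hω : |ω| ≤ ωl)
    (hsmall : 20 * (a * ωl) ≤ 1) (hΛ : Λ ≤ Λ₁)
    (hs : s * horizonCurv M a Λ₁ ≤ horizonSlope M a / 2) (hr : rPlus M a ≤ r)
    (hrs : r ≤ rPlus M a + s) :
    horizonSlope M a / 2 ≤ deriv (sepPotential M a ω m Λ) r ∧
      deriv (sepPotential M a ω m Λ) r ≤ 24 * Λ / rPlus M a ^ 3 + 184 * M / rPlus M a ^ 4 := by
  have haM : |a| ≤ M := by rw [abs_of_nonneg ha0]; linarith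
  have hrpM : M ≤ rPlus M a := M_le_rPlus M a
  have hrp0 : 0 < rPlus M a := hM.trans_le hrpM
  have hr0 : 0 < r := hrp0.trans_le hr
  have hΛ0 := hadm.nonneg
  constructor
  · have hκ := deriv_sepPotential_rPlus_ge_smallA hM ha0 ha2 hadm hω hsmall
    set g := deriv (sepPotential M a ω m Λ) with hg
    have hgd : ∀ t, rPlus M a ≤ t → HasDerivAt g (deriv g t) t := fun t ht ↦
      (hasDerivAt_deriv_sepPotential M a ω m Λ (hrp0.trans_le ht)).differentiableAt.hasDerivAt
    have hbound : ∀ t ∈ interior (Icc (rPlus M a) r), -horizonCurv M a Λ₁ ≤ deriv g t := by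
      intro t ht
      rw [interior_Icc] at ht
      have h := abs_deriv_deriv_sepPotential_le_horizonCurv hM haM hadm hΛ ht.1.le
      rw [hg]
      linarith [neg_abs_le (deriv (deriv (sepPotential M a ω m Λ)) t)]
    have hmvt := (convex_Icc (rPlus M a) r).mul_sub_le_image_sub_of_le_deriv
      (fun t ht ↦ (hgd t ht.1).continuousAt.continuousWithinAt)
      (fun t ht ↦ (hgd t (by rw [interior_Icc] at ht; exact ht.1.le)).differentiableAt.differentiableWithinAt)
      hbound (rPlus M a) (left_mem_Icc.2 hr) r (right_mem_Icc.2 hr) hr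
    have hL0 : 0 ≤ horizonCurv M a Λ₁ := by
      unfold horizonCurv
      have : 0 ≤ Λ₁ := hΛ0.trans hΛ
      positivity
    have : (r - rPlus M a) * horizonCurv M a Λ₁ ≤ s * horizonCurv M a Λ₁ :=
      mul_le_mul_of_nonneg_right (by linarith) hL0
    nlinarith
  · have h := abs_deriv_sepPotential_le hM haM hadm hr
    have h' := le_abs_self (deriv (sepPotential M a ω m Λ) r)
    have h1 : 24 * Λ / r ^ 3 ≤ 24 * Λ / rPlus M a ^ 3 := by
      apply div_le_div_of_nonneg_left (by positivity) (by positivity); gcongr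
    have h2 : 184 * M / r ^ 4 ≤ 184 * M / rPlus M a ^ 4 := by
      apply div_le_div_of_nonneg_left (by positivity) (by positivity); gcongr
    linarith

/-- **Two-sided bounds for `Ṽ = V − V(r₊)` near the horizon** (small `a`; DRSR arXiv:1402.7034,
(haty2): "`Ṽ ≐ V − V|_{r=r₊}`"): on `[r₊, r₊ + s]` with `s·L(Λ₁) ≤ κ_H/2`,
`(κ_H/2)(r − r₊) ≤ V(r) − V(r₊) ≤ (24Λ/r₊³ + 184M/r₊⁴)(r − r₊)`.
[cite: DafermosRodnianskiShlapentokhrothman2014, Prop. 8.7.1 (proof)] -/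
theorem sepPotentialTilde_near_bounds_smallA {M a ω ωl Λ Λ₁ s r : ℝ} {m : ℤ} (hM : 0 < M)
    (ha0 : 0 ≤ a) (ha2 : 2 * a ≤ M) (hadm : IsAdmissibleTriple a ω m Λ) (hω : |ω| ≤ ωl)
    (hsmall : 20 * (a * ωl) ≤ 1) (hΛ : Λ ≤ Λ₁)
    (hs : s * horizonCurv M a Λ₁ ≤ horizonSlope M a / 2) (hr : rPlus M a ≤ r)
    (hrs : r ≤ rPlus M a + s) :
    horizonSlope M a / 2 * (r - rPlus M a) ≤
        sepPotential M a ω m Λ r - sepPotential M a ω m Λ (rPlus M a) ∧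
      sepPotential M a ω m Λ r - sepPotential M a ω m Λ (rPlus M a) ≤
        (24 * Λ / rPlus M a ^ 3 + 184 * M / rPlus M a ^ 4) * (r - rPlus M a) := by
  have hrpM : M ≤ rPlus M a := M_le_rPlus M a
  have hrp0 : 0 < rPlus M a := hM.trans_le hrpM
  have hd : ∀ t, rPlus M a ≤ t → HasDerivAt (sepPotential M a ω m Λ)
      (deriv (sepPotential M a ω m Λ) t) t := fun t ht ↦
    (hasDerivAt_sepPotential M a ω m Λ (by have := hrp0.trans_le ht; positivity)).differentiableAt.hasDerivAt
  have hder : ∀ t ∈ Icc (rPlus M a) r, horizonSlope M a / 2 ≤ deriv (sepPotential M a ω m Λ) t ∧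
      deriv (sepPotential M a ω m Λ) t ≤ 24 * Λ / rPlus M a ^ 3 + 184 * M / rPlus M a ^ 4 :=
    fun t ht ↦ deriv_sepPotential_near_smallA hM ha0 ha2 hadm hω hsmall hΛ hs ht.1 (ht.2.trans hrs)
  have hcont : ContinuousOn (sepPotential M a ω m Λ) (Icc (rPlus M a) r) :=
    fun t ht ↦ (hd t ht.1).continuousAt.continuousWithinAt
  have hdiff : DifferentiableOn ℝ (sepPotential M a ω m Λ) (interior (Icc (rPlus M a) r)) :=
    fun t ht ↦ (hd t (by rw [interior_Icc] at ht; exact ht.1.le)).differentiableAt.differentiableWithinAt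
  constructor
  · exact (convex_Icc (rPlus M a) r).mul_sub_le_image_sub_of_le_deriv hcont hdiff
      (fun t ht ↦ (hder t (interior_subset ht)).1) (rPlus M a) (left_mem_Icc.2 hr) r
      (right_mem_Icc.2 hr) hr
  · exact (convex_Icc (rPlus M a) r).image_sub_le_mul_sub_of_deriv_le hcont hdiff
      (fun t ht ↦ (hder t (interior_subset ht)).2) (rPlus M a) (left_mem_Icc.2 hr) r
      (right_mem_Icc.2 hr) hr

/-! ### The middle region -/

/-- **`V ≥ V₁` on `r ≥ r₊ + s` for small `a`** (`2a² ≤ Ms`, `8Maω_l ≤ s`, `|ω| ≤ ω_l`, admissible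
with `m ≠ 0`): there `|P| ≤ ΛΔ/(r² + a²)²` because `m²Δ ≥ 4Mra|mω| + a²m²`, i.e.
`r(r − 2M) ≥ 4Mraω_l` with `r − 2M ≥ s − a²/M`. For `m = 0` the statement is
`sepPotential₁_le_sepPotential_axi`. [cite: DafermosRodnianskiShlapentokhrothman2014, Prop. 8.7.1 (proof)] -/
theorem sepPotential₁_le_sepPotential_smallA {M a ω ωl Λ s r : ℝ} {m : ℤ} (hM : 0 < M)
    (ha0 : 0 ≤ a) (ha2 : 2 * a ≤ M) (hadm : IsAdmissibleTriple a ω m Λ) (hω : |ω| ≤ ωl)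
    (hs1 : 2 * a ^ 2 ≤ M * s) (hs2 : 8 * M * a * ωl ≤ s) (hr : rPlus M a + s ≤ r) :
    sepPotential₁ M a r ≤ sepPotential M a ω m Λ r := by
  have haM : |a| ≤ M := by rw [abs_of_nonneg ha0]; linarith
  have hωl : 0 ≤ ωl := (abs_nonneg ω).trans hω
  have hs0 : 0 ≤ s := le_trans (by positivity) hs2
  have hrp := rPlus_ge_smallA hM.le ha0 ha2
  have hrpr : rPlus M a ≤ r := by linarith
  have hr0 : 0 < r := by linarith
  have hD : 0 < r ^ 2 + a ^ 2 := by positivity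
  have hΛ := hadm.nonneg
  have hm2 : (m : ℝ) ^ 2 ≤ Λ := hadm.sq_le
  rw [sepPotential_eq_axi_add_pert, sepPotential_axi_eq]
  -- suffices: pert ≥ −Λ D
  suffices h : -(Λ * (delta M a r / (r ^ 2 + a ^ 2) ^ 2)) ≤ pertPotential M a ω m r by linarith
  unfold pertPotential
  rw [show -(Λ * (delta M a r / (r ^ 2 + a ^ 2) ^ 2)) = (-(Λ * delta M a r)) / (r ^ 2 + a ^ 2) ^ 2
    by ring]
  rw [div_le_div_iff_of_pos_right (by positivity)]
  -- need: Λ Δ + 4 M r a m ω − a² m² ≥ 0; use Λ ≥ m², Δ − a² = r(r − 2M) and |4Mramω| ≤ 4Mra|m|ωl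
  have hΔ : delta M a r - a ^ 2 = r * (r - 2 * M) := by unfold delta; ring
  -- r − 2M ≥ s − a²/M ≥ 4 M a ωl
  have hsqrt := sqrt_ge_smallA hM.le ha0 ha2
  have hr2M : 4 * M * a * ωl ≤ r - 2 * M := by
    -- r ≥ r₊ + s = M + √(M²−a²) + s and M − √(M² − a²) ≤ a²/M... use (M − √)·M ≤ a²:
    have h1 : M * (M - √(M ^ 2 - a ^ 2)) ≤ a ^ 2 := by
      have hsq : √(M ^ 2 - a ^ 2) ^ 2 = M ^ 2 - a ^ 2 := Real.sq_sqrt (by nlinarith)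
      nlinarith [Real.sqrt_nonneg (M ^ 2 - a ^ 2)]
    have h2 : r - 2 * M ≥ s - (M - √(M ^ 2 - a ^ 2)) := by unfold rPlus at hr; linarith
    have h3 : M * (s - (M - √(M ^ 2 - a ^ 2))) ≥ M * s - a ^ 2 := by nlinarith
    have h4 : M * (4 * M * a * ωl) ≤ M * s - a ^ 2 := by nlinarith
    have h5 : M * (4 * M * a * ωl) ≤ M * (r - 2 * M) := by nlinarith
    exact le_of_mul_le_mul_left h5 hM
  have hmω : |(m : ℝ) * ω| ≤ |(m : ℝ)| * ωl := by
    rw [abs_mul]; exact mul_le_mul_of_nonneg_left hω (abs_nonneg _)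
  have hμ : |(m : ℝ)| ≤ (m : ℝ) ^ 2 := by
    rcases eq_or_ne m 0 with h | h
    · simp [h]
    · have : (1 : ℝ) ≤ |(m : ℝ)| := by
        rw [← Int.cast_abs]; exact_mod_cast Int.one_le_abs h
      nlinarith [sq_abs (m : ℝ)]
  have hkey : a ^ 2 * (m : ℝ) ^ 2 + 4 * M * r * a * |(m : ℝ)| * ωl ≤ Λ * delta M a r := by
    have h1 : Λ * delta M a r ≥ (m : ℝ) ^ 2 * delta M a r :=
      mul_le_mul_of_nonneg_right hm2 (delta_nonneg haM hrpr)
    have h2 : (m : ℝ) ^ 2 * delta M a r = (m : ℝ) ^ 2 * a ^ 2 + (m : ℝ) ^ 2 * (r * (r - 2 * M)) := by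
      rw [← hΔ]; ring
    have h3 : 4 * M * r * a * |(m : ℝ)| * ωl ≤ (m : ℝ) ^ 2 * (r * (r - 2 * M)) := by
      have t1 : 4 * M * r * a * |(m : ℝ)| * ωl ≤ 4 * M * r * a * (m : ℝ) ^ 2 * ωl := by
        have h0 : 0 ≤ 4 * M * r * a * ωl := by positivity
        nlinarith [mul_le_mul_of_nonneg_left hμ h0]
      have t2 : 4 * M * r * a * (m : ℝ) ^ 2 * ωl = (m : ℝ) ^ 2 * (r * (4 * M * a * ωl)) := by ring
      have t3 : r * (4 * M * a * ωl) ≤ r * (r - 2 * M) := mul_le_mul_of_nonneg_left hr2M hr0.le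
      nlinarith [sq_nonneg (m : ℝ)]
    nlinarith
  have hlast : -(4 * M * r * a * m * ω) ≤ 4 * M * r * a * |(m : ℝ)| * ωl := by
    have : |4 * M * r * a * m * ω| ≤ 4 * M * r * a * |(m : ℝ)| * ωl := by
      rw [show 4 * M * r * a * m * ω = (4 * M * r * a) * (m * ω) by ring, abs_mul,
        abs_of_nonneg (by positivity : (0 : ℝ) ≤ 4 * M * r * a)]
      have h0 : 0 ≤ 4 * M * r * a := by positivity
      nlinarith [mul_le_mul_of_nonneg_left hmω h0]
    linarith [neg_abs_le (4 * M * r * a * m * ω)]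
  linarith

end Kerr

end Literature.Geometry.Lorentzian
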